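import Mathlib
import Summits.Ventures.DiscreteObjects.Mahler.SmallMeasureCensus

/-!
# Kronecker's theorem on `[-2, 2]`: totally real algebraic integers of house `≤ 2` are `ζ + ζ⁻¹` (venture `DiscreteObjects`, target L)

Cell `pub-namedobj`, seat `pub-namedobj-mahler` (gen 8). Framing: lottery ticket; floor = certified
bounds/negative ranges.

[Kronecker 1857; McKee–Smyth, *Around the Unit Circle*, Ch. 1 (cyclotomic integers / the interval `[-2,2]`).]
If `P ∈ ℤ[X]` is monic and all its complex roots are real numbers in `[-2, 2]`, then every root of `P` is
`β + β⁻¹ = 2 Re β` for a root of unity `β` (`root_eq_add_inv_of_rootOfUnity`).  Proof: the reciprocal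
"lift" `Q(x) = x^d P(x + 1/x) ∈ ℤ[X]` (`traceLift`) has leading coefficient `1` and all its roots on the unit
circle, hence `M(Q) = 1`, so by Kronecker's theorem (Mathlib: `Polynomial.pow_eq_one_of_mahlerMeasure_eq_one`)
its roots are roots of unity.  This is the mechanism behind the trace polynomials `y = x + 1/x` of the cell's
`LehmerExactMeasure`.
-/

namespace Summit.Ventures.DiscreteObjects.Mahler

open Polynomial

/-- The reciprocal lift `Q(x) = Σ_j a_j x^{d-j} (x² + 1)^j = x^d · P(x + 1/x)` of `P = Σ_j a_j x^j`,
`d = deg P`. -/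
noncomputable def traceLift (P : ℤ[X]) : ℤ[X] :=
  ∑ j ∈ Finset.range (P.natDegree + 1), C (P.coeff j) * X ^ (P.natDegree - j) * (X ^ 2 + 1) ^ j

/-- `Q(β) = β^d · P(β + β⁻¹)` for `β ≠ 0`. -/
theorem eval_traceLift {P : ℤ[X]} {β : ℂ} (hβ : β ≠ 0) :
    ((traceLift P).map (Int.castRingHom ℂ)).eval β = β ^ P.natDegree * aeval (β + β⁻¹) P := by
  rw [traceLift, Polynomial.map_sum, eval_finsetSum, aeval_eq_sum_range, Finset.mul_sum]
  refine Finset.sum_congr rfl fun j hj => ?_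
  rw [Finset.mem_range] at hj
  rw [Polynomial.map_mul, Polynomial.map_mul, map_C, Polynomial.map_pow, map_X, Polynomial.map_pow,
    Polynomial.map_add, Polynomial.map_pow, map_X, Polynomial.map_one, eval_mul, eval_mul, eval_C,
    eval_pow, eval_X, eval_pow, eval_add, eval_pow, eval_X, eval_one, eq_intCast, zsmul_eq_mul]
  have e : (β ^ 2 + 1) = β * (β + β⁻¹) := by field_simp
  rw [e, mul_pow, show β ^ P.natDegree = β ^ (P.natDegree - j) * β ^ j by
    rw [← pow_add, Nat.sub_add_cancel (by omega)]]
  ring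

/-- The lift has degree `≤ 2d` and coefficient `1·lc(P)` in degree `2d`. -/
theorem traceLift_coeff_two_mul (P : ℤ[X]) :
    (traceLift P).natDegree ≤ 2 * P.natDegree ∧ (traceLift P).coeff (2 * P.natDegree) = P.leadingCoeff := by
  have hterm : ∀ j ∈ Finset.range (P.natDegree + 1),
      (C (P.coeff j) * X ^ (P.natDegree - j) * (X ^ 2 + 1) ^ j : ℤ[X]).natDegree ≤ P.natDegree + j := by
    intro j hj
    rw [Finset.mem_range] at hj
    calc (C (P.coeff j) * X ^ (P.natDegree - j) * (X ^ 2 + 1) ^ j : ℤ[X]).natDegree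
        ≤ (C (P.coeff j) * X ^ (P.natDegree - j)).natDegree + ((X ^ 2 + 1 : ℤ[X]) ^ j).natDegree :=
          natDegree_mul_le
      _ ≤ (P.natDegree - j) + 2 * j := by
          gcongr
          · exact (natDegree_C_mul_le _ _).trans (natDegree_X_pow_le _)
          · refine natDegree_pow_le.trans ?_
            have : (X ^ 2 + 1 : ℤ[X]).natDegree = 2 := by compute_degree!
            rw [this, mul_comm]
      _ = P.natDegree + j := by omega
  constructor
  · rw [traceLift]
    refine (natDegree_sum_le _ _).trans ?_
    refine Finset.sup_le fun j hj => ?_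
    have := hterm j hj
    rw [Finset.mem_range] at hj
    exact (this.trans (by omega))
  · rw [traceLift, finsetSum_coeff, Finset.sum_eq_single P.natDegree]
    · -- the top term
      have hm : ((X ^ 2 + 1 : ℤ[X]) ^ P.natDegree).Monic := by
        have : (X ^ 2 + 1 : ℤ[X]).Monic := by monicity!
        exact this.pow _
      have hdeg : ((X ^ 2 + 1 : ℤ[X]) ^ P.natDegree).natDegree = 2 * P.natDegree := by
        rw [natDegree_pow, show (X ^ 2 + 1 : ℤ[X]).natDegree = 2 by compute_degree!, mul_comm]
      rw [Nat.sub_self, pow_zero, mul_one, coeff_C_mul, ← hdeg, hm.coeff_natDegree, mul_one,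
        coeff_natDegree]
    · intro j hj hne
      rw [Finset.mem_range] at hj
      apply coeff_eq_zero_of_natDegree_lt
      exact (hterm j (Finset.mem_range.mpr hj)).trans_lt (by omega)
    · intro h
      exact absurd (Finset.mem_range.mpr (Nat.lt_succ_self _)) h

/-- **Kronecker's theorem on `[-2, 2]`** (Kronecker 1857): if `P ∈ ℤ[X]` is monic and every complex root of
`P` is real with absolute value `≤ 2`, then every root `α` of `P` is `β + β⁻¹` (`= 2 Re β`) for some root
of unity `β` (`β^n = 1`, `n ≥ 1`). -/
theorem root_eq_add_inv_of_rootOfUnity {P : ℤ[X]} (hmonic : P.Monic)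
    (hreal : ∀ α ∈ (P.map (Int.castRingHom ℂ)).roots, α.im = 0 ∧ ‖α‖ ≤ 2)
    {α : ℂ} (hα : α ∈ (P.map (Int.castRingHom ℂ)).roots) :
    ∃ β : ℂ, ∃ n : ℕ, 0 < n ∧ β ^ n = 1 ∧ α = β + β⁻¹ := by
  have hinj : Function.Injective (Int.castRingHom ℂ) := (Int.castRingHom ℂ).injective_int
  have hP0 : P.map (Int.castRingHom ℂ) ≠ 0 := (mem_roots'.mp hα).1
  set Q := traceLift P with hQdef
  obtain ⟨hQdeg, hQtop⟩ := traceLift_coeff_two_mul P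
  rw [hmonic.leadingCoeff] at hQtop
  have hQnat : Q.natDegree = 2 * P.natDegree :=
    le_antisymm hQdeg (le_natDegree_of_ne_zero (by rw [hQtop]; exact one_ne_zero))
  have hQlc : Q.leadingCoeff = 1 := by rw [leadingCoeff, hQnat, hQtop]
  have hQ0 : Q ≠ 0 := by intro h; rw [h, leadingCoeff_zero] at hQlc; exact zero_ne_one hQlc
  have hQC0 : Q.map (Int.castRingHom ℂ) ≠ 0 := (Polynomial.map_ne_zero_iff hinj).mpr hQ0
  -- every root `β` of `Q` is nonzero, and `β + β⁻¹` is a root of `P`, so `|β| = 1`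
  have hQcoeff0 : Q.coeff 0 = 1 := by
    rw [coeff_zero_eq_eval_zero, hQdef, traceLift, eval_finsetSum,
      Finset.sum_eq_single_of_mem P.natDegree (Finset.mem_range.mpr (Nat.lt_succ_self _))]
    · rw [Nat.sub_self, pow_zero, mul_one, eval_mul, eval_C, eval_pow, eval_add, eval_pow, eval_X,
        eval_one, coeff_natDegree, hmonic.leadingCoeff]
      norm_num
    · intro j hj hne
      rw [Finset.mem_range] at hj
      have hdj : P.natDegree - j ≠ 0 := by omega
      rw [eval_mul, eval_mul, eval_pow, eval_X, zero_pow hdj, mul_zero, zero_mul]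
  have hQeval0 : (Q.map (Int.castRingHom ℂ)).eval 0 ≠ 0 := by
    rw [eval_map, eval₂_at_zero, eq_intCast, hQcoeff0]
    norm_num
  have hβroot : ∀ β ∈ (Q.map (Int.castRingHom ℂ)).roots, β ≠ 0 ∧ β + β⁻¹ ∈ (P.map (Int.castRingHom ℂ)).roots := by
    intro β hβ
    have hev : (Q.map (Int.castRingHom ℂ)).eval β = 0 := (mem_roots hQC0).mp hβ
    have hβ0 : β ≠ 0 := by rintro rfl; exact hQeval0 hev
    refine ⟨hβ0, ?_⟩
    rw [hQdef, eval_traceLift hβ0] at hev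
    rcases mul_eq_zero.mp hev with h | h
    · exact absurd (pow_eq_zero_iff'.mp h).1 hβ0
    · rw [mem_roots hP0, IsRoot.def, ← algebraMap_int_eq, eval_map_algebraMap]
      exact h
  have hnorm : ∀ β ∈ (Q.map (Int.castRingHom ℂ)).roots, ‖β‖ = 1 := by
    intro β hβ
    obtain ⟨hβ0, hγ⟩ := hβroot β hβ
    obtain ⟨him, hle⟩ := hreal _ hγ
    -- `β² - γ β + 1 = 0` with `γ` real, `|γ| ≤ 2` forces `|β| = 1`
    set γ := β + β⁻¹ with hγdef
    have hquad : β ^ 2 - γ * β + 1 = 0 := by rw [hγdef]; field_simp; ring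
    -- write `β = x + iy`; compare with the conjugate root
    have hγreal : γ = ((γ.re : ℝ) : ℂ) := by
      apply Complex.ext <;> simp [him]
    have hprod : β * (starRingEnd ℂ β) = ((‖β‖ ^ 2 : ℝ) : ℂ) := by
      rw [Complex.mul_conj, Complex.normSq_eq_norm_sq, Complex.ofReal_pow]
    -- the conjugate `β̄` satisfies the same real quadratic, so `β̄ ∈ {β, 1/β}`:
    have hconj : (starRingEnd ℂ β) ^ 2 - γ * (starRingEnd ℂ β) + 1 = 0 := by
      have h := congrArg (starRingEnd ℂ) hquad
      rw [map_add, map_sub, map_mul, map_pow, map_one, map_zero, hγreal, Complex.conj_ofReal] at h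
      rw [hγreal]; exact h
    -- (β̄ - β)(β̄ - β⁻¹) = β̄² - γ β̄ + 1 = 0 since β + β⁻¹ = γ and β β⁻¹ = 1
    have hfac : (starRingEnd ℂ β - β) * (starRingEnd ℂ β - β⁻¹) = 0 := by
      have : (starRingEnd ℂ β - β) * (starRingEnd ℂ β - β⁻¹) =
          (starRingEnd ℂ β) ^ 2 - γ * starRingEnd ℂ β + β * β⁻¹ := by rw [hγdef]; ring
      rw [this, mul_inv_cancel₀ hβ0]
      exact hconj
    rcases mul_eq_zero.mp hfac with h | h
    · -- `β` real: `β² - γβ + 1 = 0` with `|γ| ≤ 2` real forces `γ = ±2`, `β = ±1`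
      have hβreal : β = ((β.re : ℝ) : ℂ) := by
        apply Complex.ext
        · simp
        · have := congrArg Complex.im (sub_eq_zero.mp h)
          simp only [Complex.conj_im] at this
          simp; linarith
      have hx : (β.re) ^ 2 - γ.re * β.re + 1 = 0 := by
        have h2 := hquad
        rw [hβreal, hγreal] at h2
        exact_mod_cast h2
      have hγle : |γ.re| ≤ 2 := by
        have := Complex.abs_re_le_norm γ
        linarith
      -- discriminant `γ² - 4 ≤ 0` and a real root ⇒ `γ² = 4`, `β.re = γ/2 = ±1`
      have habs : |β.re| = 1 := by
        have h4 : (2 * β.re - γ.re) ^ 2 = γ.re ^ 2 - 4 := by nlinarith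
        obtain ⟨hg1, hg2⟩ := abs_le.mp hγle
        have hγ2 : γ.re ^ 2 ≤ 4 := by nlinarith
        have hsq : (2 * β.re - γ.re) ^ 2 = 0 :=
          le_antisymm (by nlinarith [sq_nonneg (2 * β.re - γ.re)]) (sq_nonneg _)
        have h5 : 2 * β.re - γ.re = 0 := by
          have := sq_eq_zero_iff.mp hsq
          exact this
        have hsq1 : β.re ^ 2 = 1 := by nlinarith
        have h3 : (|β.re| - 1) * (|β.re| + 1) = 0 := by nlinarith [sq_abs β.re, abs_nonneg β.re]
        rcases mul_eq_zero.mp h3 with h6 | h6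
        · linarith
        · linarith [abs_nonneg β.re]
      rw [hβreal, Complex.norm_real, Real.norm_eq_abs, habs]
    · -- `β̄ = β⁻¹`: `|β|² = β β̄ = 1`
      have h1 : β * starRingEnd ℂ β = 1 := by rw [sub_eq_zero.mp h, mul_inv_cancel₀ hβ0]
      rw [hprod] at h1
      have : ‖β‖ ^ 2 = 1 := by exact_mod_cast h1
      nlinarith [norm_nonneg β]
  -- hence `M(Q) = 1`
  have hMQ : (Q.map (Int.castRingHom ℂ)).mahlerMeasure = 1 := by
    rw [mahlerMeasure_eq_leadingCoeff_mul_prod_roots, leadingCoeff_map_of_injective hinj, hQlc, map_one,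
      norm_one, one_mul]
    apply Multiset.prod_eq_one
    intro x hx
    rw [Multiset.mem_map] at hx
    obtain ⟨β, hβ, rfl⟩ := hx
    rw [hnorm β hβ, max_self]
  -- a root `β` of `Q` above `α`
  obtain ⟨him, hle⟩ := hreal α hα
  obtain ⟨r, hr⟩ := IsAlgClosed.exists_pow_nat_eq (α ^ 2 - 4) (by norm_num : 0 < 2)
  have hdisc : discrim (1 : ℂ) (-α) 1 = r * r := by rw [discrim]; linear_combination -hr
  obtain ⟨β, hβdef⟩ : ∃ β : ℂ, β = (-(-α) + r) / (2 * 1) := ⟨_, rfl⟩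
  have hβquad : 1 * (β * β) + (-α) * β + 1 = 0 :=
    (quadratic_eq_zero_iff one_ne_zero hdisc β).mpr (Or.inl hβdef)
  have hβ0 : β ≠ 0 := by
    intro h; rw [h] at hβquad; norm_num at hβquad
  have hαβ : α = β + β⁻¹ := by
    have h1 : α * β = β * β + 1 := by linear_combination -hβquad
    field_simp
    linear_combination h1
  have hβQ : β ∈ (Q.map (Int.castRingHom ℂ)).roots := by
    rw [mem_roots hQC0, IsRoot.def, hQdef, eval_traceLift hβ0, ← hαβ]
    have : aeval α P = 0 := by
      have h := (mem_roots hP0).mp hα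
      rwa [IsRoot.def, ← algebraMap_int_eq, eval_map_algebraMap] at h
    rw [this, mul_zero]
  have hβar : β ∈ Q.aroots ℂ := by
    rw [aroots_def, algebraMap_int_eq]; exact hβQ
  obtain ⟨n, hn, hβn⟩ := Polynomial.pow_eq_one_of_mahlerMeasure_eq_one hMQ hβ0 hβar
  exact ⟨β, n, hn, hβn, hαβ⟩

end Summit.Ventures.DiscreteObjects.Mahler
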